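import Summits.ABC.ABC.Theorems.IneffectiveSubspaceDeepRegimeABCRoughPowerfulTail
import Summits.ABC.ABC.Theses.IneffectiveSubspace

/-!
# Stub `stub_roughPowerfulCellIff` of line `Sketch` — crux `IneffectiveSubspace.DepthCountedABC` (stmt-ABC-14938)

THE RIDOUT NORMAL FORM OF THE CRUX.  The crux `DepthCountedABC` is abc with exponent `1+ε` and one
constant `C(K, ε)` on each cell `ω₅(abc) := #{p : v_p(abc) ≥ 5} ≤ K`.  This file proves that it is
EQUIVALENT to the same statement restricted to the triples of the cell whose `y`-rough powerful
excess `X_y := Σ_{p > y, p ∣ abc} (v_p(abc) − 1)·log p` is at least `θ·log c`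
(`0 < θ`, `θ(1+ε) < ε`; `y, C` free):

* `roughPowerfulCell_of_depthCountedABC` (→): ignore the excess hypothesis, `y := 0`;
* `depthCountedABC_of_roughPowerfulCell` (←): given `K, ε` put `η := ε/(4(1+ε))`, `θ := 2η`, take
  `y, C₀` from the hypothesis and `B` from Ridout (`DeepRegimeABC.ridoutCoreBound_holds y η`: the
  CORED triples, `(2+η) log c ≤ Σ_{p ≤ y} v_p(abc) log p + log(c/min(a,b))`, are bounded), and answer
  `C := max (max C₀ (exp (log 2/η))) (B+1)`.  A cored triple has `c ≤ B < C ≤ C·rad^(1+ε)`; a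
  coreless violator of `c < C·rad^(1+ε)` has `(1+ε) log rad ≤ log c`, rough support mass
  `Σ_{p>y} log p ≤ log rad` (`DeepRegimeABC.sum_rough_log_le_log_rad`), rough mass
  `> (1−η) log c − log 2` (`DeepRegimeABC.roughMass_gt_of_coreMass_lt`) and `η log c ≥ log 2`, hence
  excess `≥ 2η log c = θ log c` (`DeepRegimeABC.roughExcess_eq_roughMass_sub`), so the hypothesis
  gives `c < C₀·rad^(1+ε) ≤ C·rad^(1+ε)` — contradiction;
* `stub_roughPowerfulCellIff`: the equivalence (the registered stub of the skeleton
  `Cruxes/DepthCountedABC/Lines/Sketch.lean`).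

VERBATIM PARALLEL to the landed sister result for the crux `DeepRegimeABC`
(`Summit.ABC.ABC.Theorems.DeepRegimeABC.deepRegimeABC_iff_roughPowerfulTail`, files
`IneffectiveSubspaceDeepRegimeABCRoughPowerfulTail.lean` / `…StubRoughReduction.lean`), with the tail
condition `K ≤ ω₅` replaced by the cell condition `ω₅ ≤ K` and `K` quantified outside.  Sources:
elementary bookkeeping (folklore) over the landed `DeepRegimeABC` lemmas; Ridout's theorem enters only
through the PROVED `ridoutCoreBound_holds`.  Deliberately NOT here: any claim about the crux itself or
about the other stubs of the line.
-/

-- `Summit.<Summit>.<Problem>` is the mandated summit-side namespace (CONVENTIONS §2); for the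
-- single-conjunct summit `ABC` the two coincide, so the duplicate `ABC.ABC` is deliberate.
set_option linter.dupNamespace false

namespace Summit.ABC.ABC.Theorems.DepthCountedABC

open Literature.NumberTheory.DiophantineGeometry

/-- **The crux implies its Ridout normal form** (ignore the excess hypothesis; `y := 0`). [folklore] -/
theorem roughPowerfulCell_of_depthCountedABC
    (h : Summit.ABC.ABC.Theses.IneffectiveSubspace.DepthCountedABC) :
    ∀ K : ℕ, ∀ ε : ℝ, 0 < ε → ∀ θ : ℝ, 0 < θ → θ * (1 + ε) < ε → ∃ y : ℕ, ∃ C : ℝ, 0 < C ∧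
      ∀ a b c : ℕ, IsABCTriple a b c →
        ((a * b * c).primeFactors.filter (fun p => 5 ≤ (a * b * c).factorization p)).card ≤ K →
        θ * Real.log c ≤
          ∑ p ∈ (a * b * c).primeFactors.filter (fun p => ¬ p ≤ y),
            (((a * b * c).factorization p : ℝ) - 1) * Real.log p →
        (c : ℝ) < C * ((rad a b c : ℕ) : ℝ) ^ (1 + ε) := by
  intro K ε hε θ _ _
  obtain ⟨C, hC, hK⟩ := h K ε hε
  exact ⟨0, C, hC, fun a b c habc hKle _ => hK a b c habc hKle⟩

/-- **The Ridout normal form implies the crux.**  Given `K, ε`, put `η := ε/(4(1+ε))`, `θ := 2η`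
(`θ(1+ε) = ε/2 < ε`), take `y, C₀` from the hypothesis at `(K, ε, θ)` and `B` from
`DeepRegimeABC.ridoutCoreBound_holds y η`, and answer `C := max (max C₀ (exp (log 2/η))) (B+1)`:
CORED triples of the cell have `c ≤ B < C ≤ C·rad^(1+ε)`, and a CORELESS triple of the cell violating
`c < C·rad^(1+ε)` has rough powerful excess `≥ θ·log c` (mass bookkeeping, exactly as in
`DeepRegimeABC.stub_roughReduction`), so the hypothesis bounds it — contradiction. [folklore] -/
theorem depthCountedABC_of_roughPowerfulCell
    (hT : ∀ K : ℕ, ∀ ε : ℝ, 0 < ε → ∀ θ : ℝ, 0 < θ → θ * (1 + ε) < ε → ∃ y : ℕ, ∃ C : ℝ, 0 < C ∧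
      ∀ a b c : ℕ, IsABCTriple a b c →
        ((a * b * c).primeFactors.filter (fun p => 5 ≤ (a * b * c).factorization p)).card ≤ K →
        θ * Real.log c ≤
          ∑ p ∈ (a * b * c).primeFactors.filter (fun p => ¬ p ≤ y),
            (((a * b * c).factorization p : ℝ) - 1) * Real.log p →
        (c : ℝ) < C * ((rad a b c : ℕ) : ℝ) ^ (1 + ε)) :
    Summit.ABC.ABC.Theses.IneffectiveSubspace.DepthCountedABC := by
  -- adapted from Summits/ABC/ABC/Theorems/IneffectiveSubspaceDeepRegimeABCStubRoughReduction.lean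
  -- (`stub_roughReduction`) and …RoughPowerfulTail.lean (`deepRegimeABC_of_roughPowerfulTail`)
  intro K ε hε
  have hε1 : (0 : ℝ) < 1 + ε := by linarith
  -- the parameters: `η = ε/(4(1+ε))`, `θ = 2η`
  set η : ℝ := ε / (4 * (1 + ε)) with hη
  have hη0 : 0 < η := by positivity
  have hη4 : 4 * η * (1 + ε) = ε := by
    rw [hη]
    field_simp
  obtain ⟨y, C₀, hC₀, hmain⟩ :=
    hT K ε hε (2 * η) (by positivity) (by linarith [hη4])
  obtain ⟨B, hB⟩ := DeepRegimeABC.ridoutCoreBound_holds y η hη0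
  set c₁ : ℝ := Real.exp (Real.log 2 / η) with hc₁
  have hc₁1 : 1 ≤ c₁ := Real.one_le_exp (div_nonneg (Real.log_nonneg (by norm_num)) hη0.le)
  set C : ℝ := max (max C₀ c₁) (B + 1) with hC
  have hC0 : C₀ ≤ C := (le_max_left _ _).trans (le_max_left _ _)
  have hC1 : c₁ ≤ C := (le_max_right _ _).trans (le_max_left _ _)
  have hCB : B + 1 ≤ C := le_max_right _ _
  have hCone : 1 ≤ C := hc₁1.trans hC1
  refine ⟨C, hC₀.trans_le hC0, fun a b c habc hK => ?_⟩
  obtain ⟨ha, -, hsum, -⟩ := id habc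
  have hc : 0 < c := by omega
  have hcR : (0 : ℝ) < (c : ℝ) := by exact_mod_cast hc
  have hrad1 : (1 : ℝ) ≤ ((rad a b c : ℕ) : ℝ) := by
    rw [rad_def]
    exact_mod_cast Nat.pos_of_ne_zero UniqueFactorizationMonoid.radical_ne_zero
  have hrad0 : (0 : ℝ) < ((rad a b c : ℕ) : ℝ) := by linarith
  have hrpow1 : (1 : ℝ) ≤ ((rad a b c : ℕ) : ℝ) ^ (1 + ε) :=
    DeepRegimeABC.one_le_rad_rpow' a b c hε
  have hrpow0 : (0 : ℝ) ≤ ((rad a b c : ℕ) : ℝ) ^ (1 + ε) := zero_le_one.trans hrpow1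
  by_cases hcore :
      (∑ p ∈ (a * b * c).primeFactors.filter (fun p => p ≤ y),
            ((a * b * c).factorization p : ℝ) * Real.log p)
          + Real.log ((c : ℝ) / ((min a b : ℕ) : ℝ)) < (2 + η) * Real.log c
  · -- CORELESS: a violator has rough powerful excess `≥ θ log c`, so the hypothesis bounds it
    by_contra hnot
    push Not at hnot
    -- `hnot : C * rad^(1+ε) ≤ c`
    -- (a) `c ≥ c₁`, so `η · log c ≥ log 2`; and `rad^(1+ε) ≤ c`, so `(1+ε) log rad ≤ log c`
    have hc_ge : c₁ ≤ (c : ℝ) := by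
      calc c₁ ≤ C := hC1
        _ = C * 1 := (mul_one C).symm
        _ ≤ C * ((rad a b c : ℕ) : ℝ) ^ (1 + ε) :=
            mul_le_mul_of_nonneg_left hrpow1 (by linarith)
        _ ≤ (c : ℝ) := hnot
    have hlogc : Real.log 2 / η ≤ Real.log c := by
      rw [← Real.log_exp (Real.log 2 / η)]
      exact Real.log_le_log (Real.exp_pos _) hc_ge
    have hηL : Real.log 2 ≤ η * Real.log c := by
      rw [div_le_iff₀ hη0] at hlogc
      linarith
    have hrc : ((rad a b c : ℕ) : ℝ) ^ (1 + ε) ≤ (c : ℝ) := by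
      calc ((rad a b c : ℕ) : ℝ) ^ (1 + ε) = 1 * ((rad a b c : ℕ) : ℝ) ^ (1 + ε) := (one_mul _).symm
        _ ≤ C * ((rad a b c : ℕ) : ℝ) ^ (1 + ε) := mul_le_mul_of_nonneg_right hCone hrpow0
        _ ≤ (c : ℝ) := hnot
    have hlogrc : (1 + ε) * Real.log ((rad a b c : ℕ) : ℝ) ≤ Real.log c := by
      have h := Real.log_le_log (by positivity) hrc
      rwa [Real.log_rpow hrad0] at h
    -- (b) the rough support has mass `≤ log rad ≤ log c − 4η log c = log c/(1+ε)`
    have hS := DeepRegimeABC.sum_rough_log_le_log_rad y a b c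
    have hρ : Real.log ((rad a b c : ℕ) : ℝ) ≤ Real.log c - 4 * η * Real.log c := by
      have h1 : (1 + ε) * (Real.log c - 4 * η * Real.log c) = Real.log c := by
        have h2 : (1 + ε) * (Real.log c - 4 * η * Real.log c)
            = (1 + ε) * Real.log c - (4 * η * (1 + ε)) * Real.log c := by ring
        rw [h2, hη4]
        ring
      refine le_of_mul_le_mul_left ?_ hε1
      rw [h1]
      exact hlogrc
    -- (c) the rough mass is `> (1−η) log c − log 2`, so the rough excess is `≥ 2η log c = θ log c`
    have hR := DeepRegimeABC.roughMass_gt_of_coreMass_lt (y := y) habc hcore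
    have hX : 2 * η * Real.log c ≤
        ∑ p ∈ (a * b * c).primeFactors.filter (fun p => ¬ p ≤ y),
          (((a * b * c).factorization p : ℝ) - 1) * Real.log p := by
      rw [DeepRegimeABC.roughExcess_eq_roughMass_sub]
      linarith [hR, hS, hρ, hηL]
    -- (d) the hypothesis bounds the triple: contradiction
    have hlt := hmain a b c habc hK hX
    have hCC : C₀ * ((rad a b c : ℕ) : ℝ) ^ (1 + ε) ≤ C * ((rad a b c : ℕ) : ℝ) ^ (1 + ε) :=
      mul_le_mul_of_nonneg_right hC0 hrpow0
    linarith
  · -- CORED: bounded by Ridout (`ridoutCoreBound_holds`), absorbed since `rad^(1+ε) ≥ 1`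
    have hcB : (c : ℝ) ≤ B := hB a b c habc (not_lt.mp hcore)
    have hCnn : (0 : ℝ) ≤ C := zero_le_one.trans hCone
    calc (c : ℝ) ≤ B := hcB
      _ < B + 1 := by linarith
      _ ≤ C := hCB
      _ = C * 1 := (mul_one _).symm
      _ ≤ C * ((rad a b c : ℕ) : ℝ) ^ (1 + ε) := mul_le_mul_of_nonneg_left hrpow1 hCnn

/-- **Stub `stub_roughPowerfulCellIff` — the Ridout normal form of the crux.**  `DepthCountedABC` is
EQUIVALENT to abc with exponent `1+ε` on the cell `ω₅(abc) ≤ K` for the triples whose `y`-rough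
powerful excess `Σ_{p>y, p∣abc} (v_p(abc) − 1)·log p` is at least `θ·log c` (`0 < θ`, `θ(1+ε) < ε`;
`y, C` free): Ridout's theorem (through the landed `DeepRegimeABC.ridoutCoreBound_holds`) removes every
CORED configuration, and the coreless ones are rough-powerful by mass bookkeeping. [folklore] -/
theorem stub_roughPowerfulCellIff :
    Summit.ABC.ABC.Theses.IneffectiveSubspace.DepthCountedABC ↔
    (∀ K : ℕ, ∀ ε : ℝ, 0 < ε → ∀ θ : ℝ, 0 < θ → θ * (1 + ε) < ε → ∃ y : ℕ, ∃ C : ℝ, 0 < C ∧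
      ∀ a b c : ℕ, Literature.NumberTheory.DiophantineGeometry.IsABCTriple a b c →
        ((a * b * c).primeFactors.filter (fun p => 5 ≤ (a * b * c).factorization p)).card ≤ K →
        θ * Real.log c ≤
          ∑ p ∈ (a * b * c).primeFactors.filter (fun p => ¬ p ≤ y),
            (((a * b * c).factorization p : ℝ) - 1) * Real.log p →
        (c : ℝ) < C * ((Literature.NumberTheory.DiophantineGeometry.rad a b c : ℕ) : ℝ) ^ (1 + ε)) :=
  ⟨roughPowerfulCell_of_depthCountedABC, depthCountedABC_of_roughPowerfulCell⟩

end Summit.ABC.ABC.Theorems.DepthCountedABC
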